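import Mathlib
import Literature.MathematicalPhysics.QuantumFieldTheory.BalabanImbrieJaffe1984to88.BIJ85AxialMinimizer413
import Literature.MathematicalPhysics.QuantumFieldTheory.BalabanImbrieJaffe1984to88.BIJ85LandauMinimizer442

/-!
# `BalabanImbrieJaffe1984to88.BIJ85Prop511Proof` — T. Bałaban, J. Imbrie, A. Jaffe, *Renormalization of the Higgs model:
minimizers, propagators and the stability of mean field theory*, Commun. Math. Phys. **97** (1985) 299–329
[BalabanImbrieJaffe1985]: **Proposition 5.1.1** p. 313–315 [PDF 15–17] — `H_{k,Ax}B − H_kB = ∂λ` (5.1.1) with `λ = λ(H_kB)` the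
gauge function of (5.1.4)/(5.1.13) — PROVED, abstractly, for the axial gauge minimizer `H_{k,Ax}` of (4.1.3) as typed in
`…BIJ85AxialMinimizer413` and the Landau gauge minimizer `H_k` of (4.4.2) as typed in `…BIJ85LandauMinimizer442`

statement-level skeleton of published theorems with citation tags; proofs where landed; nothing here is a claim about the Yang–Mills mass gap

PDF held: `paper:balaban1985-cmp97-bij-higgs-minimizers` (journal page = PDF page + 298); pp. 313–315 [PDF 15–17] read from the OCR
text (`lit read … --pages 15-17`) AND the render `run/shared/lean/pub/lit-balaban/lit-balaban-r15/pages/1985-cmp97-bij-higgs-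
minimizers-p016-x2.png` (the displays (5.1.4)–(5.1.9) exactly).

CITATION HEADER (lean-in-tree rule).  Phase-2 proof seat p30 (gen 4) of the mega-formalization `lit-balaban` (HOME
`run/shared/lean/pub/lit-balaban/`, unit `lit-balaban-p30-g4`); SKELETON row **C1.Prop5.1.1** (decl cells so far:
`BIJ85Sect4Statements.GaugeRG.lam514` / `GaugeRG.Prop511` over the abstract carrier `GaugeRG`, «typed p239474»).  File 1 of the row
(abstract theorem); file 2 = `…BIJ85Prop511Torus` (the instance on the torus `T^{(0)}` of the series' lattice calculus, hypothesis-
free in the standing range); file 3 = `…BIJ85FaddeevPopov519` (the printed Faddeev–Popov displays (5.1.8)–(5.1.9) as measure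
identities).

THE PRINTED TEXT (p. 313–315, verbatim).  *"5.1. Change of Gauge for Minimizers.  In this section we discuss relations among the
operators H and G. We begin by relating H_{k,Ax} and H_k. Recall that H_kB is the configuration which minimizes the action ½‖∂A‖²,
subject to a gauge condition as well as the restriction Q_kA = B on field averages. We claim that H_{k,Ax}B and H_kB differ by a
gauge transformation, H_{k,Ax}B − H_kB = ∂λ. (5.1.1) We show that λ is an explicit, linear function of H_kB. … Proposition 5.1.1.
The relation (5.1.1) holds with λ(x) = −Σ_{j=0}^{k−1} L^{j−k}[(Q_jH_kB)(Γ_{x_{j+1},x_j}) − Σ_{x′∈B(x_{j+1})}(L^{−d}Q_jH_kB)(Γ_{x_{j+1},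
x′})]. (5.1.4) … Proof. … We use a variant of the Faddeev-Popov procedure … [(5.1.5)–(5.1.9)] … In order to evaluate (5.1.9), we
solve the system of linear equations for λ which result from the delta functions δ(Q′_kλ) and δ_{k,Ax}(A + ∂λ). Using this value
of λ = λ(A), we have H_{k,Ax}B = Z_k(B)⁻¹∫dA δ(Q_kA − B)𝒢(∂*A)exp(−½‖∂A‖²)(A + ∂λ(A)). … [(5.1.10)–(5.1.13)] … We now notice that
λ = λ(A) is a linear function of A. … Since H_kB minimizes the quadratic form ‖∂A‖² subject to the restrictions imposed by
δ(Q_kA − B) and 𝒢, the term in (5.1.14) involving ∂λ(A − H_kB) is linear in A − H_kB and hence its integral vanishes. Thus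
H_{k,Ax}B = H_kB + ∂λ(H_kB), and the proof of Proposition 5.1.1 is complete."*

WHAT IS PROVED HERE, and how it maps onto the printed proof.  The setting is the common one of the two typed minimizers: the
η-lattice bond fields form a finite-dimensional real inner-product space `EA`, the five operators `∂, ∂*, Δ, Q_k, Q′` are p11's
carrier `BIJ85LandauForm441.LandauOps` with the abelian gauge structure `∂∂λ = 0, ∂*∂λ = Δλ, Q_k∂λ = 0 (Q′λ = 0)` ([6I] (1.20);
`LandauOps.GaugeStructure grad`), the axial gauge `δ_{k,Ax}` is a linear subspace `Ax ⊆ EA` ((4.1.2), `…BIJ85AxialPropagator411.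
deltaAx` on the torus) and the domain of (4.1.1)/(4.1.3) is the subspace `V = {Q_kA = 0} ∩ Ax` (hypothesis `hV`).  THE GAUGE
FUNCTION λ enters exactly through what the paper proves about it in (5.1.10)–(5.1.13) (kernel-checked by p08 gen 2,
`…BIJ85Eq5113Proof.existsUnique_gaugeFn` / `eq5113`): a LINEAR map `lam : EA →ₗ[ℝ] ES` with `Q′(λ(A)) = 0` (`hlamQ`, the
δ-function δ(Q′_kλ)), `A + ∂λ(A) ∈ Ax` (`hlamAx`, the δ-function δ_{k,Ax}(A + ∂λ)) and uniqueness (`hlamU`: any `μ` with `Q′μ = 0`,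
`A + ∂μ ∈ Ax` IS `λ(A)`).  The two non-degeneracy inputs are the printed ones of the Landau-gauge files: no zero modes (`hZ`, the
Landau-gauge form of the p. 309 claim, [6I] p. 30) and «Δ positive definite on N(Q′)» (`hL`, [6I] p. 25).
* `exists_landau_gauge` — every field is gauge-equivalent, by a `λ ∈ N(Q′)`, to one in the Landau gauge `R∂*A = 0` (this is
  why `R` is the projection onto `ΔN(Q′)`, [6I] p. 25);
* `Hk_minimizes_on_fibre` — the p. 313 sentence in its strong form used on p. 315: **`H_kB` minimizes `½‖∂A‖²` over the WHOLE
  fibre `{Q_kA = B}`** (gauge invariance of `‖∂A‖²` + `exists_landau_gauge` + p11's `Hk_isLandauMinimizer`);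
* `noZeroModes_axial` — the p. 309 claim *"Such zero modes do not occur"* for the AXIAL constraint space `V`, DERIVED from the
  Landau-gauge no-zero-modes input and the uniqueness of the gauge function (so (4.1.3)–(4.1.4) converge: p09's `Zax_pos`);
* **`prop511`** — PROPOSITION 5.1.1: for every `B` and every axial representative `A₀` (`Q_kA₀ = B`, `A₀ ∈ Ax`; one exists as
  soon as the fibre is non-empty, `exists_axial_rep`), `H_{k,Ax}B − H_kB = ∂λ(H_kB)` with `H_{k,Ax}B = BIJ85AxialMinimizer413.Hax
  V ∂ A₀` ((4.1.3), a Bochner integral, = the constrained minimizer by p09's `Hax_eq_minimizer`) and `H_kB =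
  BIJ85LandauMinimizer442.Hk D B` ((4.4.2), a fibre integral, = the Landau minimizer by p11's `Hk_spec`).  ROUTE (the last step of
  the printed proof, (5.1.14)–(5.1.15), in minimizer form): `H_kB + ∂λ(H_kB)` lies in the axial class of `A₀` and has the same
  curl as `H_kB`, which minimizes `‖∂·‖` over the whole fibre ⊇ the axial class; by uniqueness of the axial minimizer (p09's
  `eq_Hax_of_norm_le`) it IS `H_{k,Ax}B`.  The Faddeev–Popov manipulation (5.1.5)–(5.1.9) of the functional integrals themselves
  is file 3 (`…BIJ85FaddeevPopov519`), where (5.1.1) is re-derived along the printed route.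
Carrier clauses (F6): which concrete operators/subspaces these are is the instance's (file 2 gives the torus instance with every
hypothesis discharged).  Theorems only; no new definitions, no `def … : Prop`; axioms: the standard three.
-/

namespace Literature.MathematicalPhysics.QuantumFieldTheory.BalabanImbrieJaffe1984to88.BIJ85Prop511Proof

open MeasureTheory
open Literature.MathematicalPhysics.QuantumFieldTheory.BalabanImbrieJaffe1984to88.BIJ85LandauForm441
open Literature.MathematicalPhysics.QuantumFieldTheory.BalabanImbrieJaffe1984to88.BIJ85LandauMinimizer442
open Literature.MathematicalPhysics.QuantumFieldTheory.BalabanImbrieJaffe1984to88.BIJ85AxialMinimizer413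

noncomputable section

variable {EA ES EP EB ES' : Type*}
  [NormedAddCommGroup EA] [InnerProductSpace ℝ EA]
  [NormedAddCommGroup ES] [InnerProductSpace ℝ ES] [FiniteDimensional ℝ ES]
  [NormedAddCommGroup EP] [InnerProductSpace ℝ EP]
  [AddCommGroup EB] [Module ℝ EB] [AddCommGroup ES'] [Module ℝ ES']
  (D : LandauOps EA ES EP EB ES')

/-! ## §1  Reaching the Landau gauge; `H_kB` minimizes `½‖∂A‖²` on the whole fibre -/

/-- **Every field can be put in the Landau gauge of [6I]** by a gauge transformation with gauge function in `N(Q′)`: for every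
`A` there is `μ`, `Q′μ = 0`, with `R∂*(A + ∂μ) = 0` — because `R` is the orthogonal projection onto `ΔN(Q′)` ([6I] p. 25, *"The
projection operator R has a clear meaning. It is an orthogonal projection on the linear subspace ΔN(Q′_k)"*), `R∂*A = Δμ₀` for some
`μ₀ ∈ N(Q′)` and `μ = −μ₀` does it (`∂*∂μ = Δμ`, `RΔμ = Δμ` on `N(Q′)`). [cite: Balaban1984PropagatorsI, p.25 (text)] -/
theorem exists_landau_gauge {grad : ES →ₗ[ℝ] EA} (hg : D.GaugeStructure grad) (A : EA) :
    ∃ μ : ES, D.Qp μ = 0 ∧ D.projR (D.dstar (A + grad μ)) = 0 := by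
  obtain ⟨l, hl, hleq⟩ : ∃ l ∈ D.kerQp, D.lap l = D.projR (D.dstar A) :=
    Submodule.mem_map.mp (D.gaugeRange.starProjection_apply_mem (D.dstar A))
  have hl' : D.Qp l = 0 := (D.mem_kerQp).mp hl
  refine ⟨-l, by rw [map_neg, hl', neg_zero], ?_⟩
  rw [map_add, hg.dstar_grad, map_neg, map_add, map_neg, D.projR_lap_of_mem hl', hleq, add_neg_cancel]

variable [FiniteDimensional ℝ EA] [MeasurableSpace EA] [BorelSpace EA] [MeasurableSpace ES] [BorelSpace ES]

/-- **p. 313 / p. 315, the minimizing property of `H_kB` on the WHOLE fibre**: p. 313 *"H_kB is the configuration which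
minimizes the action ½‖∂A‖², subject to a gauge condition as well as the restriction Q_kA = B"*, used on p. 315 as *"Since H_kB
minimizes the quadratic form ‖∂A‖² subject to the restrictions imposed by δ(Q_kA − B) and 𝒢 …"* — since `‖∂A‖²` is gauge
invariant (`∂∂μ = 0`) and every `A` with `Q_kA = B` is gauge-equivalent inside the fibre to a Landau-gauge field
(`exists_landau_gauge`, `Q_k∂μ = 0`), the Landau minimizer satisfies `½‖∂H_kB‖² ≤ ½‖∂A‖²` for EVERY `A` with `Q_kA = B`.
[cite: BalabanImbrieJaffe1985, p.313 (text)] -/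
theorem Hk_minimizes_on_fibre (hZ : ∀ v : EA, D.Qk v = 0 → D.curl v = 0 → D.projR (D.dstar v) = 0 → v = 0)
    (hL : ∀ l : ES, D.Qp l = 0 → D.lap l = 0 → l = 0) {grad : ES →ₗ[ℝ] EA} (hg : D.GaugeStructure grad)
    {B : EB} {A : EA} (hA : D.Qk A = B) :
    (1 / 2 : ℝ) * ‖D.curl (Hk D B)‖ ^ 2 ≤ (1 / 2 : ℝ) * ‖D.curl A‖ ^ 2 := by
  obtain ⟨-, -, hmin⟩ := Hk_isLandauMinimizer D hZ hL hg ⟨A, hA⟩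
  obtain ⟨μ, hμ, hR⟩ := exists_landau_gauge D hg A
  have hQ : D.Qk (A + grad μ) = B := by rw [map_add, hg.Qk_grad μ hμ, add_zero, hA]
  have h := hmin (A + grad μ) hQ hR
  rwa [map_add, hg.curl_grad, add_zero] at h

/-- The same without the factor ½ and the square: `‖∂H_kB‖ ≤ ‖∂A‖` on the fibre `{Q_kA = B}`.
[cite: BalabanImbrieJaffe1985, p.313 (text)] -/
theorem norm_curl_Hk_le (hZ : ∀ v : EA, D.Qk v = 0 → D.curl v = 0 → D.projR (D.dstar v) = 0 → v = 0)
    (hL : ∀ l : ES, D.Qp l = 0 → D.lap l = 0 → l = 0) {grad : ES →ₗ[ℝ] EA} (hg : D.GaugeStructure grad)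
    {B : EB} {A : EA} (hA : D.Qk A = B) : ‖D.curl (Hk D B)‖ ≤ ‖D.curl A‖ := by
  have h := Hk_minimizes_on_fibre D hZ hL hg hA
  have h2 : ‖D.curl (Hk D B)‖ ^ 2 ≤ ‖D.curl A‖ ^ 2 := by linarith
  exact (pow_le_pow_iff_left₀ (norm_nonneg _) (norm_nonneg _) two_ne_zero).1 h2

/-! ## §2  The axial gauge: no zero modes (p. 309) from the Landau-gauge input and the uniqueness of `λ` -/

omit [FiniteDimensional ℝ EA] [MeasurableSpace EA] [BorelSpace EA] [MeasurableSpace ES] [BorelSpace ES] in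
/-- **p. 309, the axial-gauge no-zero-modes claim, DERIVED** (verbatim: *"The reader may wonder whether ∂ has zero modes on the
subspace of gauge fields satisfying Q_kA = 0 and satisfying the axial gauge condition. Such zero modes do not occur, and as a
consequence the integral (4.1.1) is convergent also for noncompact gauge fields"*): given the Landau-gauge no-zero-modes input
`hZ` and the UNIQUENESS of the gauge function of (5.1.13) (`hlamU`: the only `μ ∈ N(Q′)` with `A + ∂μ` axial is `λ(A)`), a field
with `Q_kv = 0`, `δ_{k,Ax}(v)` and `∂v = 0` vanishes.  (Route: gauge `v` into the Landau gauge inside `{Q_k = 0}`, where `hZ`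
kills it, so `v = ∂(−μ)` is a pure gauge with `μ ∈ N(Q′)`; then `0 + ∂(−μ) = v` is axial, so `−μ = λ(0) = 0`.)
[cite: BalabanImbrieJaffe1985, p.309 (text)] -/
theorem noZeroModes_axial (hZ : ∀ v : EA, D.Qk v = 0 → D.curl v = 0 → D.projR (D.dstar v) = 0 → v = 0)
    {grad : ES →ₗ[ℝ] EA} (hg : D.GaugeStructure grad) (Ax : Submodule ℝ EA) (lam : EA →ₗ[ℝ] ES)
    (hlamU : ∀ (A : EA) (μ : ES), D.Qp μ = 0 → A + grad μ ∈ Ax → μ = lam A)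
    {v : EA} (hQ : D.Qk v = 0) (hAx : v ∈ Ax) (hcurl : D.curl v = 0) : v = 0 := by
  obtain ⟨μ, hμ, hR⟩ := exists_landau_gauge D hg v
  have hQ' : D.Qk (v + grad μ) = 0 := by rw [map_add, hg.Qk_grad μ hμ, add_zero, hQ]
  have hc' : D.curl (v + grad μ) = 0 := by rw [map_add, hg.curl_grad, add_zero, hcurl]
  have hv0 : v + grad μ = 0 := hZ _ hQ' hc' hR
  have hv : v = (0 : EA) + grad (-μ) := by rw [map_neg, zero_add, eq_neg_iff_add_eq_zero, hv0]
  have hμ' : D.Qp (-μ) = 0 := by rw [map_neg, hμ, neg_zero]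
  have hmem : (0 : EA) + grad (-μ) ∈ Ax := hv ▸ hAx
  have hlam : -μ = lam 0 := hlamU 0 (-μ) hμ' hmem
  rw [map_zero, neg_eq_zero] at hlam
  rw [hv, hlam, neg_zero, map_zero, add_zero]

omit [FiniteDimensional ℝ EA] [MeasurableSpace EA] [BorelSpace EA] [MeasurableSpace ES] [BorelSpace ES] in
/-- The no-zero-modes statement in the form consumed by `…BIJ85AxialMinimizer413` (hypothesis `hD` there): `∂` is injective on
the constraint subspace `V = {Q_kA = 0} ∩ {δ_{k,Ax}(A)}` of (4.1.1). [cite: BalabanImbrieJaffe1985, p.309 (text)] -/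
theorem noZeroModes_V (hZ : ∀ v : EA, D.Qk v = 0 → D.curl v = 0 → D.projR (D.dstar v) = 0 → v = 0)
    {grad : ES →ₗ[ℝ] EA} (hg : D.GaugeStructure grad) {Ax V : Submodule ℝ EA}
    (hV : ∀ A : EA, A ∈ V ↔ D.Qk A = 0 ∧ A ∈ Ax) (lam : EA →ₗ[ℝ] ES)
    (hlamU : ∀ (A : EA) (μ : ES), D.Qp μ = 0 → A + grad μ ∈ Ax → μ = lam A) :
    ∀ v : V, D.curl (v : EA) = 0 → v = 0 := by
  intro v hv
  have h := (hV (v : EA)).1 v.2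
  exact Subtype.ext (noZeroModes_axial D hZ hg Ax lam hlamU h.1 h.2 hv)

/-! ## §3  Proposition 5.1.1 -/

omit [FiniteDimensional ℝ EA] [MeasurableSpace EA] [BorelSpace EA] [FiniteDimensional ℝ ES] [MeasurableSpace ES]
  [BorelSpace ES] in
/-- **An axial representative exists on every non-empty fibre**: `A + ∂λ(A)` has `Q_k(A + ∂λ(A)) = Q_kA` (*"using Q_kA → Q_kA +
Q_k∂λ = Q_kA + ∂Q′_kλ = Q_kA, on account of the δ function"*, p. 314) and satisfies `δ_{k,Ax}`.
[cite: BalabanImbrieJaffe1985, (5.1.8) p.314] -/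
theorem exists_axial_rep {grad : ES →ₗ[ℝ] EA} (hg : D.GaugeStructure grad) (Ax : Submodule ℝ EA) (lam : EA →ₗ[ℝ] ES)
    (hlamQ : ∀ A : EA, D.Qp (lam A) = 0) (hlamAx : ∀ A : EA, A + grad (lam A) ∈ Ax) {B : EB} {A : EA} (hA : D.Qk A = B) :
    D.Qk (A + grad (lam A)) = B ∧ A + grad (lam A) ∈ Ax :=
  ⟨by rw [map_add, hg.Qk_grad _ (hlamQ A), add_zero, hA], hlamAx A⟩

/-- **`H_kB + ∂λ(H_kB)` is an axial-gauge field with `Q_k`-average `B`** — it lies in the domain `{Q_kA = B, δ_{k,Ax}(A)}` of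
(4.1.3), i.e. in the class `A₀ + V` of any axial representative `A₀`. [cite: BalabanImbrieJaffe1985, (5.1.9) p.314] -/
theorem Hk_add_grad_sub_mem (hZ : ∀ v : EA, D.Qk v = 0 → D.curl v = 0 → D.projR (D.dstar v) = 0 → v = 0)
    (hL : ∀ l : ES, D.Qp l = 0 → D.lap l = 0 → l = 0) {grad : ES →ₗ[ℝ] EA} (hg : D.GaugeStructure grad)
    {Ax V : Submodule ℝ EA} (hV : ∀ A : EA, A ∈ V ↔ D.Qk A = 0 ∧ A ∈ Ax) (lam : EA →ₗ[ℝ] ES)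
    (hlamQ : ∀ A : EA, D.Qp (lam A) = 0) (hlamAx : ∀ A : EA, A + grad (lam A) ∈ Ax)
    {B : EB} {A₀ : EA} (hA₀ : D.Qk A₀ = B) (hA₀Ax : A₀ ∈ Ax) :
    Hk D B + grad (lam (Hk D B)) - A₀ ∈ V := by
  obtain ⟨hQH, -, -, -⟩ := Hk_spec D hZ hL ⟨A₀, hA₀⟩
  obtain ⟨hQ, hAx⟩ := exists_axial_rep D hg Ax lam hlamQ hlamAx hQH
  refine (hV _).2 ⟨?_, Ax.sub_mem hAx hA₀Ax⟩
  rw [map_sub, hQ, hA₀, sub_self]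

variable [FiniteDimensional ℝ EP]

/-- **Proposition 5.1.1** p. 314 [PDF 16] (with (5.1.1) p. 313), verbatim: *"We claim that H_{k,Ax}B and H_kB differ by a gauge
transformation, H_{k,Ax}B − H_kB = ∂λ. (5.1.1) … Proposition 5.1.1. The relation (5.1.1) holds with [λ of (5.1.4) = λ(H_kB) of
(5.1.13)]"* — PROVED: for every `B` and every axial representative `A₀` of the (4.1.3) class (`Q_kA₀ = B`, `δ_{k,Ax}(A₀)`),
`H_{k,Ax}B − H_kB = ∂λ(H_kB)`, where `H_{k,Ax}B = Hax V ∂ A₀` is the Bochner integral (4.1.3) of `…BIJ85AxialMinimizer413`, `H_kB =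
Hk D B` the fibre integral (4.4.2) of `…BIJ85LandauMinimizer442`, and `λ` is the linear gauge-function map characterized by
(5.1.13) (`Q′λ(A) = 0`, `δ_{k,Ax}(A + ∂λ(A))`, uniqueness).  Inputs: no zero modes `hZ` ([6I] p. 30 / p. 309), «Δ positive definite
on N(Q′)» `hL` ([6I] p. 25), the abelian gauge structure `hg` ([6I] (1.20)).  Route = the printed conclusion (5.1.14)–(5.1.15) in
minimizer form: `H_kB + ∂λ(H_kB)` is in the axial class, `‖∂(H_kB + ∂λ(H_kB))‖ = ‖∂H_kB‖ ≤ ‖∂H_{k,Ax}B‖` (`Hk_minimizes_on_fibre`),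
and the axial minimizer is unique (`eq_Hax_of_norm_le`, no zero modes by `noZeroModes_V`).
[cite: BalabanImbrieJaffe1985, Prop. 5.1.1 p.314] -/
theorem prop511 (hZ : ∀ v : EA, D.Qk v = 0 → D.curl v = 0 → D.projR (D.dstar v) = 0 → v = 0)
    (hL : ∀ l : ES, D.Qp l = 0 → D.lap l = 0 → l = 0) {grad : ES →ₗ[ℝ] EA} (hg : D.GaugeStructure grad)
    {Ax V : Submodule ℝ EA} (hV : ∀ A : EA, A ∈ V ↔ D.Qk A = 0 ∧ A ∈ Ax) (lam : EA →ₗ[ℝ] ES)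
    (hlamQ : ∀ A : EA, D.Qp (lam A) = 0) (hlamAx : ∀ A : EA, A + grad (lam A) ∈ Ax)
    (hlamU : ∀ (A : EA) (μ : ES), D.Qp μ = 0 → A + grad μ ∈ Ax → μ = lam A)
    {B : EB} {A₀ : EA} (hA₀ : D.Qk A₀ = B) (hA₀Ax : A₀ ∈ Ax) :
    Hax V D.curl A₀ - Hk D B = grad (lam (Hk D B)) := by
  have hD := noZeroModes_V D hZ hg hV lam hlamU
  have hmem := Hk_add_grad_sub_mem D hZ hL hg hV lam hlamQ hlamAx hA₀ hA₀Ax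
  -- `Q_k(H_{k,Ax}B) = B`: the axial minimizer lies in the class of `A₀`
  have hQax : D.Qk (Hax V D.curl A₀) = B := by
    have h := ((hV _).1 (Hax_sub_mem hD A₀)).1
    rw [map_sub, sub_eq_zero] at h
    rw [h, hA₀]
  -- `‖∂(H_kB + ∂λ(H_kB))‖ = ‖∂H_kB‖ ≤ ‖∂H_{k,Ax}B‖`
  have hle : ‖D.curl (Hk D B + grad (lam (Hk D B)))‖ ≤ ‖D.curl (Hax V D.curl A₀)‖ := by
    rw [map_add, hg.curl_grad, add_zero]
    exact norm_curl_Hk_le D hZ hL hg hQax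
  have h := eq_Hax_of_norm_le hD A₀ hmem hle
  rw [← h, add_sub_cancel_left]

/-- (5.1.1) solved for the axial minimizer: `H_{k,Ax}B = H_kB + ∂λ(H_kB)` (*"Thus H_{k,Ax}B = H_kB + ∂λ(H_kB), and the proof of
Proposition 5.1.1 is complete"*, p. 315). [cite: BalabanImbrieJaffe1985, (5.1.15) p.315] -/
theorem Hax_eq_Hk_add_grad (hZ : ∀ v : EA, D.Qk v = 0 → D.curl v = 0 → D.projR (D.dstar v) = 0 → v = 0)
    (hL : ∀ l : ES, D.Qp l = 0 → D.lap l = 0 → l = 0) {grad : ES →ₗ[ℝ] EA} (hg : D.GaugeStructure grad)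
    {Ax V : Submodule ℝ EA} (hV : ∀ A : EA, A ∈ V ↔ D.Qk A = 0 ∧ A ∈ Ax) (lam : EA →ₗ[ℝ] ES)
    (hlamQ : ∀ A : EA, D.Qp (lam A) = 0) (hlamAx : ∀ A : EA, A + grad (lam A) ∈ Ax)
    (hlamU : ∀ (A : EA) (μ : ES), D.Qp μ = 0 → A + grad μ ∈ Ax → μ = lam A)
    {B : EB} {A₀ : EA} (hA₀ : D.Qk A₀ = B) (hA₀Ax : A₀ ∈ Ax) :
    Hax V D.curl A₀ = Hk D B + grad (lam (Hk D B)) := by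
  rw [← prop511 D hZ hL hg hV lam hlamQ hlamAx hlamU hA₀ hA₀Ax, add_sub_cancel]

/-- **(5.1.1) as stated — *"H_{k,Ax}B and H_kB differ by a gauge transformation, H_{k,Ax}B − H_kB = ∂λ"*** — with the gauge
function in `N(Q′_k)` (the δ-function `δ(Q′_kλ)` of (5.1.9)). [cite: BalabanImbrieJaffe1985, (5.1.1) p.313] -/
theorem eq511 (hZ : ∀ v : EA, D.Qk v = 0 → D.curl v = 0 → D.projR (D.dstar v) = 0 → v = 0)
    (hL : ∀ l : ES, D.Qp l = 0 → D.lap l = 0 → l = 0) {grad : ES →ₗ[ℝ] EA} (hg : D.GaugeStructure grad)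
    {Ax V : Submodule ℝ EA} (hV : ∀ A : EA, A ∈ V ↔ D.Qk A = 0 ∧ A ∈ Ax) (lam : EA →ₗ[ℝ] ES)
    (hlamQ : ∀ A : EA, D.Qp (lam A) = 0) (hlamAx : ∀ A : EA, A + grad (lam A) ∈ Ax)
    (hlamU : ∀ (A : EA) (μ : ES), D.Qp μ = 0 → A + grad μ ∈ Ax → μ = lam A)
    {B : EB} {A₀ : EA} (hA₀ : D.Qk A₀ = B) (hA₀Ax : A₀ ∈ Ax) :
    ∃ μ : ES, D.Qp μ = 0 ∧ Hax V D.curl A₀ - Hk D B = grad μ :=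
  ⟨lam (Hk D B), hlamQ _, prop511 D hZ hL hg hV lam hlamQ hlamAx hlamU hA₀ hA₀Ax⟩

/-- Proposition 5.1.1 from the NON-EMPTINESS of the fibre alone: with `A₀ := A + ∂λ(A)` for any `A` with `Q_kA = B` (the axial
representative produced by the gauge function itself), `H_{k,Ax}B = Hax V ∂ (A + ∂λ(A)) = H_kB + ∂λ(H_kB)`.
[cite: BalabanImbrieJaffe1985, Prop. 5.1.1 p.314] -/
theorem prop511_of_mem_fibre (hZ : ∀ v : EA, D.Qk v = 0 → D.curl v = 0 → D.projR (D.dstar v) = 0 → v = 0)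
    (hL : ∀ l : ES, D.Qp l = 0 → D.lap l = 0 → l = 0) {grad : ES →ₗ[ℝ] EA} (hg : D.GaugeStructure grad)
    {Ax V : Submodule ℝ EA} (hV : ∀ A : EA, A ∈ V ↔ D.Qk A = 0 ∧ A ∈ Ax) (lam : EA →ₗ[ℝ] ES)
    (hlamQ : ∀ A : EA, D.Qp (lam A) = 0) (hlamAx : ∀ A : EA, A + grad (lam A) ∈ Ax)
    (hlamU : ∀ (A : EA) (μ : ES), D.Qp μ = 0 → A + grad μ ∈ Ax → μ = lam A)
    {B : EB} {A : EA} (hA : D.Qk A = B) :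
    Hax V D.curl (A + grad (lam A)) - Hk D B = grad (lam (Hk D B)) := by
  obtain ⟨hQ, hAx⟩ := exists_axial_rep D hg Ax lam hlamQ hlamAx hA
  exact prop511 D hZ hL hg hV lam hlamQ hlamAx hlamU hQ hAx

omit [FiniteDimensional ℝ ES] [MeasurableSpace ES] [BorelSpace ES] [FiniteDimensional ℝ EP] in
/-- *"λ is an explicit, linear function of H_kB"* (p. 313) — and `H_{k,Ax}B` does not depend on the axial representative chosen for
the class: two axial representatives with the same `Q_k`-average give the same `H_{k,Ax}B` (p09's `Hax_congr`).
[cite: BalabanImbrieJaffe1985, (4.1.3) p.310] -/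
theorem Hax_rep_irrel {Ax V : Submodule ℝ EA} (hV : ∀ A : EA, A ∈ V ↔ D.Qk A = 0 ∧ A ∈ Ax)
    {A₀ A₁ : EA} (hQ : D.Qk A₁ = D.Qk A₀) (h₀ : A₀ ∈ Ax) (h₁ : A₁ ∈ Ax) :
    Hax V D.curl A₁ = Hax V D.curl A₀ :=
  Hax_congr V D.curl ((hV _).2 ⟨by rw [map_sub, hQ, sub_self], Ax.sub_mem h₁ h₀⟩)

/-! ## §4  (5.2.8): `∂H_{k,Ax} = ∂H_k` — v1.1 append (p30 gen 4) -/

/-- **(5.2.8)** p. 316 [PDF 18], verbatim (proof of Prop. 5.2.2): *"We use three facts: the formula (5.2.1), the fact that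
H*_{j,Ax}∂* = H*_j∂*, (5.2.8) is gauge invariant, and formulas (5.1.1), (5.1.4)"* — in its form on configurations (the adjoint of
the printed operator identity): `∂H_{k,Ax}B = ∂H_kB` for every `B`, an immediate consequence of Proposition 5.1.1 (`H_{k,Ax}B =
H_kB + ∂λ(H_kB)`) and `∂∂λ = 0`.  Setting and hypotheses as in `prop511`. [cite: BalabanImbrieJaffe1985, (5.2.8) p.316] -/
theorem eq528 (hZ : ∀ v : EA, D.Qk v = 0 → D.curl v = 0 → D.projR (D.dstar v) = 0 → v = 0)
    (hL : ∀ l : ES, D.Qp l = 0 → D.lap l = 0 → l = 0) {grad : ES →ₗ[ℝ] EA} (hg : D.GaugeStructure grad)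
    {Ax V : Submodule ℝ EA} (hV : ∀ A : EA, A ∈ V ↔ D.Qk A = 0 ∧ A ∈ Ax) (lam : EA →ₗ[ℝ] ES)
    (hlamQ : ∀ A : EA, D.Qp (lam A) = 0) (hlamAx : ∀ A : EA, A + grad (lam A) ∈ Ax)
    (hlamU : ∀ (A : EA) (μ : ES), D.Qp μ = 0 → A + grad μ ∈ Ax → μ = lam A)
    {B : EB} {A₀ : EA} (hA₀ : D.Qk A₀ = B) (hA₀Ax : A₀ ∈ Ax) :
    D.curl (Hax V D.curl A₀) = D.curl (Hk D B) := by
  rw [Hax_eq_Hk_add_grad D hZ hL hg hV lam hlamQ hlamAx hlamU hA₀ hA₀Ax, map_add, hg.curl_grad, add_zero]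

open scoped InnerProductSpace in
/-- (5.2.8) in pairing form: `⟨∂H_{k,Ax}B, f⟩ = ⟨∂H_kB, f⟩` for every plaquette field `f` — i.e. `⟨B, H*_{k,Ax}∂*f⟩ = ⟨B, H*_k∂*f⟩`,
the printed operator identity `H*_{k,Ax}∂* = H*_k∂*` read weakly (H_{k,Ax}, H_k as operators on B are p09's `Hop` /
p11's `Hk`). [cite: BalabanImbrieJaffe1985, (5.2.8) p.316] -/
theorem eq528_inner (hZ : ∀ v : EA, D.Qk v = 0 → D.curl v = 0 → D.projR (D.dstar v) = 0 → v = 0)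
    (hL : ∀ l : ES, D.Qp l = 0 → D.lap l = 0 → l = 0) {grad : ES →ₗ[ℝ] EA} (hg : D.GaugeStructure grad)
    {Ax V : Submodule ℝ EA} (hV : ∀ A : EA, A ∈ V ↔ D.Qk A = 0 ∧ A ∈ Ax) (lam : EA →ₗ[ℝ] ES)
    (hlamQ : ∀ A : EA, D.Qp (lam A) = 0) (hlamAx : ∀ A : EA, A + grad (lam A) ∈ Ax)
    (hlamU : ∀ (A : EA) (μ : ES), D.Qp μ = 0 → A + grad μ ∈ Ax → μ = lam A)
    {B : EB} {A₀ : EA} (hA₀ : D.Qk A₀ = B) (hA₀Ax : A₀ ∈ Ax) (f : EP) :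
    ⟪D.curl (Hax V D.curl A₀), f⟫_ℝ = ⟪D.curl (Hk D B), f⟫_ℝ := by
  rw [eq528 D hZ hL hg hV lam hlamQ hlamAx hlamU hA₀ hA₀Ax]

/-- **The curl of the two minimizers has the same norm** — so `H_{k,Ax}B` and `H_kB` have the same action `½‖∂A‖²` (p. 313: both
minimize it, subject to their gauge conditions, on the fibre `Q_kA = B`). [cite: BalabanImbrieJaffe1985, p.313 (text)] -/
theorem norm_curl_Hax_eq (hZ : ∀ v : EA, D.Qk v = 0 → D.curl v = 0 → D.projR (D.dstar v) = 0 → v = 0)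
    (hL : ∀ l : ES, D.Qp l = 0 → D.lap l = 0 → l = 0) {grad : ES →ₗ[ℝ] EA} (hg : D.GaugeStructure grad)
    {Ax V : Submodule ℝ EA} (hV : ∀ A : EA, A ∈ V ↔ D.Qk A = 0 ∧ A ∈ Ax) (lam : EA →ₗ[ℝ] ES)
    (hlamQ : ∀ A : EA, D.Qp (lam A) = 0) (hlamAx : ∀ A : EA, A + grad (lam A) ∈ Ax)
    (hlamU : ∀ (A : EA) (μ : ES), D.Qp μ = 0 → A + grad μ ∈ Ax → μ = lam A)
    {B : EB} {A₀ : EA} (hA₀ : D.Qk A₀ = B) (hA₀Ax : A₀ ∈ Ax) :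
    ‖D.curl (Hax V D.curl A₀)‖ = ‖D.curl (Hk D B)‖ := by
  rw [eq528 D hZ hL hg hV lam hlamQ hlamAx hlamU hA₀ hA₀Ax]

end

end Literature.MathematicalPhysics.QuantumFieldTheory.BalabanImbrieJaffe1984to88.BIJ85Prop511Proof
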